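import Summits.Ventures.Crystal3D.Theorems.StickyWulffConstantTextureLiminfTexShadowCertificateDefs
import HarnessLib

/-!
# FAULT INVISIBILITY: layers of two Hägg words that agree on a window coincide up to an in-plane re-anchoring
# (lane T, crux `TextureLiminfV5`, stmt-Ventures-23912; cf-p1 DECISIONS (xcii)(1) / (xciii)(5) idle-queue item, 2026-08-29)

HONEST FRAMING. Venture `Summits/Ventures/Crystal3D` (cell `crystal3d-full`), helper `--supports` the law-v5 crux `TextureLiminfV5`
(stmt-Ventures-23912).  Pure Barlow-stacking bookkeeping (standard axioms); rung F-C1 not moved.  cf-p1 (xcii)(1): «faulted» means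
«global Hägg word not constant»; a fault plane that misses the clamped cylinder is INVISIBLE to the cell data `X ∩ cyl` — to be stated once
as a lemma for the owners of the faulted stubs (19480-p2 twin-aware ledger, 19481-p1 F_layer).  This file is that lemma, in the form the
tree's `barlowPos` convention dictates: layer `k` sits at lateral offset `haggLabel s k • w` (`w = barlowOffset`, cumulative label
anchored at layer `0`), so two words that agree on the layers `k₁ ≤ i < k₂` have THE SAME layers `k₁ ≤ k ≤ k₂` up to the in-plane translation
`d • w`, `d = haggLabel s k₁ − haggLabel s' k₁` (the labels accumulated below the window):
* `haggWindow_congr`, `haggLabel_sub_eq_of_agree` — window sums / label differences depend only on the letters inside;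
* `barlowPos_eq_add_of_agree` — `barlowPos s k i j = barlowPos s' k i j + d • w` for every window layer `k`;
* `stacking_window_iff_of_agree` — for a presentation `(L, t)`: the window layers of `(L, t, σ)` ARE the window layers of `(L, t + L (d • w), σ')`;
* `laySlab_add_inplane` — the slabs `laySlab L t i` are unchanged by the re-anchoring (`(d • w)₂ = 0`), so a charge table indexed by slabs is
  read identically in both presentations.
Use: a faulted plate whose faults all lie outside the layers meeting `cyl(R₀+1, h, ρ)` presents, inside that cylinder, exactly the sites of the
fcc (constant-word) plate `(L, t + L (d • w), const)` — whichever mechanism prices the cell may read the window word as constant.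
WHAT THIS IS NOT: no wall-law statement; no change of any stub; F-C1 not moved.
-/

noncomputable section

namespace Summit.Ventures.Crystal3D.Cruxes.TextureLiminf.TexShadow

open Summit.Ventures.Crystal3D
open Literature.MathematicalPhysics.StatisticalMechanics (IsHaggSeq barlowStacking barlowPos barlowOffset haggLabel haggWindow
  haggLabel_add_natCast layerNormal triangularVec₁ triangularVec₂)

/-- A window sum depends only on the letters inside the window. -/
theorem haggWindow_congr {s s' : ℤ → ℤ} {m : ℤ} {n : ℕ} (h : ∀ i, m ≤ i → i < m + n → s i = s' i) :
    haggWindow s m n = haggWindow s' m n := by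
  unfold haggWindow
  refine Finset.sum_congr rfl fun i hi => ?_
  have hi' : i < n := Finset.mem_range.1 hi
  exact h _ (by omega) (by omega)

/-- **Label differences across a window depend only on the letters inside it**: if `s` and `s'` agree on `k₁ ≤ i < k`, then
`haggLabel s k − haggLabel s k₁ = haggLabel s' k − haggLabel s' k₁`. -/
theorem haggLabel_sub_eq_of_agree {s s' : ℤ → ℤ} {k₁ k : ℤ} (hk : k₁ ≤ k)
    (h : ∀ i, k₁ ≤ i → i < k → s i = s' i) :
    haggLabel s k - haggLabel s k₁ = haggLabel s' k - haggLabel s' k₁ := by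
  obtain ⟨n, rfl⟩ := Int.le.dest hk
  rw [haggLabel_add_natCast, haggLabel_add_natCast,
    haggWindow_congr (s := s) (s' := s') (m := k₁) (n := n) fun i h1 h2 => h i h1 h2]
  ring

/-- **Window layers of agreeing words coincide up to `d • w`**, `d = haggLabel s k₁ − haggLabel s' k₁`: for every layer `k ≥ k₁` below
which (from `k₁` on) the words agree, `barlowPos s k i j = barlowPos s' k i j + d • w`. -/
theorem barlowPos_eq_add_of_agree (a c : ℝ) {s s' : ℤ → ℤ} {k₁ k : ℤ} (hk : k₁ ≤ k)
    (h : ∀ i, k₁ ≤ i → i < k → s i = s' i) (i j : ℤ) :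
    barlowPos a c s k i j =
      barlowPos a c s' k i j + ((haggLabel s k₁ - haggLabel s' k₁ : ℤ) : ℝ) • barlowOffset a := by
  have hl : (haggLabel s k : ℝ) = (haggLabel s' k : ℝ) + ((haggLabel s k₁ - haggLabel s' k₁ : ℤ) : ℝ) := by
    have := haggLabel_sub_eq_of_agree hk h
    push_cast
    linarith [(by exact_mod_cast this :
      (haggLabel s k : ℝ) - haggLabel s k₁ = haggLabel s' k - haggLabel s' k₁)]
  unfold barlowPos
  rw [hl, add_smul]
  abel

/-- **The window of a presented stacking**: for a presentation `(L, t)` and words agreeing on `k₁ ≤ i < k₂`, a point is a window site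
(`k₁ ≤ k ≤ k₂`) of `(L, t, σ)` iff it is a window site of `(L, t + L (d • w), σ')`. -/
theorem stacking_window_iff_of_agree (L : E3 ≃ₗᵢ[ℝ] E3) (t : E3) {σ σ' : ℤ → ℤ} {k₁ k₂ : ℤ}
    (h : ∀ i, k₁ ≤ i → i < k₂ → σ i = σ' i) (y : E3) :
    (∃ k i j : ℤ, k₁ ≤ k ∧ k ≤ k₂ ∧ y = L (barlowPos 1 (Real.sqrt (2 / 3)) σ k i j) + t) ↔
      (∃ k i j : ℤ, k₁ ≤ k ∧ k ≤ k₂ ∧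
        y = L (barlowPos 1 (Real.sqrt (2 / 3)) σ' k i j) +
          (t + L (((haggLabel σ k₁ - haggLabel σ' k₁ : ℤ) : ℝ) • barlowOffset 1))) := by
  constructor
  · rintro ⟨k, i, j, hk₁, hk₂, rfl⟩
    refine ⟨k, i, j, hk₁, hk₂, ?_⟩
    rw [barlowPos_eq_add_of_agree 1 (Real.sqrt (2 / 3)) hk₁ (fun m h1 h2 => h m h1 (lt_of_lt_of_le h2 hk₂)) i j,
      map_add]
    abel
  · rintro ⟨k, i, j, hk₁, hk₂, rfl⟩
    refine ⟨k, i, j, hk₁, hk₂, ?_⟩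
    rw [barlowPos_eq_add_of_agree 1 (Real.sqrt (2 / 3)) hk₁ (fun m h1 h2 => h m h1 (lt_of_lt_of_le h2 hk₂)) i j,
      map_add]
    abel

/-- **The layer slabs are blind to the in-plane re-anchoring**: `laySlab L (t + L (d • w)) i = laySlab L t i` (`w₂ = 0`). -/
theorem laySlab_add_inplane (L : E3 ≃ₗᵢ[ℝ] E3) (t : E3) (d : ℝ) (i : ℤ) :
    laySlab L (t + L (d • barlowOffset 1)) i = laySlab L t i := by
  have hw2 : (d • barlowOffset (1 : ℝ)) 2 = 0 := by simp [barlowOffset]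
  ext y
  unfold laySlab
  constructor
  · rintro ⟨r, ⟨hr1, hr2⟩, rfl⟩
    refine ⟨r + d • barlowOffset 1, ⟨?_, ?_⟩, ?_⟩
    · show (i : ℝ) * Real.sqrt (2 / 3) < (r + d • barlowOffset 1) 2
      rw [PiLp.add_apply, hw2, add_zero]; exact hr1
    · show (r + d • barlowOffset 1) 2 < ((i : ℝ) + 1) * Real.sqrt (2 / 3)
      rw [PiLp.add_apply, hw2, add_zero]; exact hr2
    · simp only [map_add]; abel
  · rintro ⟨r, ⟨hr1, hr2⟩, rfl⟩
    refine ⟨r - d • barlowOffset 1, ⟨?_, ?_⟩, ?_⟩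
    · show (i : ℝ) * Real.sqrt (2 / 3) < (r - d • barlowOffset 1) 2
      rw [PiLp.sub_apply, hw2, sub_zero]; exact hr1
    · show (r - d • barlowOffset 1) 2 < ((i : ℝ) + 1) * Real.sqrt (2 / 3)
      rw [PiLp.sub_apply, hw2, sub_zero]; exact hr2
    · simp only [map_sub]; abel

end Summit.Ventures.Crystal3D.Cruxes.TextureLiminf.TexShadow

end
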